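import Summits.CriticalPhenomena.SAWScalingLimit.Theorems.SAWDevelopingMapObservableToSLECanonicalTransferDictionary
import Summits.CriticalPhenomena.SAWScalingLimit.Theorems.SAWDevelopingMapObservableToSLECanonicalTransferPendantSandwich
import HarnessLib

/-!
# Crux `SAWDevelopingMap.ObservableToSLE` (stmt-CriticalPhenomena-10472), line
`floor-ratio-restriction-bootstrap`, stub `stub_canonicalTransfer`: the fixed-scale squeeze
(pendant lowest row)

Landing target:
`Summits/CriticalPhenomena/SAWScalingLimit/Theorems/SAWDevelopingMapObservableToSLECanonicalTransferSqueezePendant.lean`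
(`--supports stmt-CriticalPhenomena-10472`).  Pendant companion of `…CanonicalTransferSqueeze.lean`:
at the mesh parameters with `frac(2h/(√3 δ)) ∈ [1/3, 2/3)` the canonical endpoints `a ≠ b` of
`stub_canonicalTransfer` are PENDANT vertices of `Ω_δ` (unique `Ω_δ`-neighbours `a'`, `b'` in the
first full row), outside every admissible family; the canonical walks are `a → a' ⇝ b' → b` and
the admissible partition functions are taken between the vertical mid-edges `s_a = {a', a}`,
`s_b = {b', b}`.  With the inner admissible domain `Λ ∌ a, b` without bad edges, the event
`In = {γ ⊆ Λ ∪ {a, b}}` and two `D'`-families `Λ' ⊆ Λ'' ⊆ Λ` (`Λ'` without bad `Ω'`-edges, `Λ''`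
closed under `Ω'`-mesh steps inside `Λ`), the event `E` of the stub satisfies
`Σ_{γ ∈ In} x^{#v} = x² Z_Λ`, `x² Z_{Λ'} ≤ Σ_{γ ∈ E ∩ In} x^{#v} ≤ x² Z_{Λ''}`
(`sum_ite_inside_eq_sq_mul_sum`, `sq_mul_sum_le_sum_ite_meshEvent_inside`,
`sum_ite_meshEvent_inside_le_sq_mul_sum`), whence the registered sub-goal
`stub_canonicalTransfer_squeezePendant`: `P(In)·Z_{Λ'} ≤ P(E ∩ In)·Z_Λ ≤ P(In)·Z_{Λ''}`.
-/

noncomputable section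

open scoped BigOperators Classical ENNReal
open MeasureTheory
open Literature.Probability.LatticeModels (HexVertex hexGraph hexCenter)
open Literature.Probability.RandomPlanarGeometry
open Literature.Probability.RandomPlanarGeometry.SAW

namespace Summit.CriticalPhenomena.SAWScalingLimit.Theorems.ObservableToSLE.FloorRatio

section Pendant

variable {V : Type*} {G : SimpleGraph V} {Ω Ω' : Set ℂ} {δ : ℝ} {Λ Λ' Λ'' : Finset HexVertex}
  {a b a' b' : HexVertex}

/-- Local copy of `support_subset_of_darts_closed` (`…CanonicalTransferSqueeze.lean`): a walk
starting in `S`, each of whose darts leads from `S` into `S`, stays in `S`. [folklore] -/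
private theorem support_subset_of_darts_closed_loc {S : Set V} {u v : V} (p : G.Walk u v)
    (hu : u ∈ S) (h : ∀ d ∈ p.darts, d.fst ∈ S → d.snd ∈ S) : ∀ w ∈ p.support, w ∈ S := by
  induction p with
  | nil => intro w hw; rw [SimpleGraph.Walk.support_nil, List.mem_singleton] at hw; exact hw ▸ hu
  | @cons x y z hadj q ih =>
    intro w hw
    rw [SimpleGraph.Walk.support_cons, List.mem_cons] at hw
    rcases hw with rfl | hw
    · exact hu
    · have hy : y ∈ S :=
        h ⟨(x, y), hadj⟩ (by rw [SimpleGraph.Walk.darts_cons]; exact List.mem_cons.2 (Or.inl rfl)) hu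
      refine ih hy (fun d hd => h d ?_) w hw
      rw [SimpleGraph.Walk.darts_cons]
      exact List.mem_cons_of_mem _ hd

/-- `s_a = {a', a} ≠ s_b = {b', b}` for `a ≠ b`, `a' ≠ b`. [folklore] -/
private theorem sym2_ne_of_pendant (hab : a ≠ b) (ha'b : a' ≠ b) : s(a', a) ≠ s(b', b) := by
  intro h
  rcases Sym2.eq_iff.1 h with ⟨-, h2⟩ | ⟨h1, -⟩
  · exact hab h2
  · exact ha'b h1

/-- **`Σ_{γ canonical, γ ⊆ Λ ∪ {a,b}} x^{#vertices(γ)} = x² Z_Λ(s_a, s_b)`, pendant endpoints**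
(`a ≠ b` pendant with unique `Ω_δ`-neighbours `a' ∈ Λ`, `b'`, `a' ≠ b`, outside `Λ`; no bad edge
inside `Λ`): strip the two forced end-steps. [cite: LawlerSchrammWerner2004SAW, §3.4 ("SAW satisfies restriction")] -/
theorem sum_ite_inside_eq_sq_mul_sum [Fintype (HexDomainSAW Ω δ a b)]
    (hΛ : ∀ v ∈ Λ, ∀ w ∈ Λ, hexGraph.Adj v w → (hexDomainGraph Ω δ).Adj v w)
    (hab : a ≠ b) (haΛ : a ∉ Λ) (hbΛ : b ∉ Λ) (ha'Λ : a' ∈ Λ) (ha'b : a' ≠ b)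
    (ha : ∀ w, (hexDomainGraph Ω δ).Adj a w ↔ w = a')
    (hb : ∀ w, (hexDomainGraph Ω δ).Adj b w ↔ w = b') (x : ℝ) :
    (∑ γ : HexDomainSAW Ω δ a b,
        if ∀ v ∈ γ.walk.support, v ∈ Λ ∨ v = a ∨ v = b then x ^ γ.vertexCount else 0) =
      x ^ 2 * ∑ γ : HexMidEdgeSAW Λ s(a', a) s(b', b), x ^ γ.length := by
  have hne := sym2_ne_of_pendant (a' := a') (b' := b') hab ha'b
  have hadj : hexGraph.Adj a' a := (embDomainGraph_le hexGraph hexCenter Ω δ ((ha a').2 rfl)).symm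
  obtain ⟨e₁, he₁⟩ := exists_equiv_isPath_pendant (G := hexDomainGraph Ω δ) hab ha hb ha'b
  obtain ⟨e₃, he₃⟩ := exists_equiv_isPath_of_le (embDomainGraph_le hexGraph hexCenter Ω δ)
    (Λ := (↑Λ : Set HexVertex)) (fun v hv w hw h => hΛ v hv w hw h) a' b'
  obtain ⟨e₄, he₄⟩ := exists_equiv_isPath_hexMidEdgeSAW (vb := b') ha'Λ haΛ hbΛ hadj hne
  have hIn : ∀ p : {p : (hexDomainGraph Ω δ).Walk a b // p.IsPath},
      (∀ v ∈ p.1.support, v ∈ Λ ∨ v = a ∨ v = b) ↔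
      ∀ v ∈ (e₁ p).1.support, v ∈ (↑Λ : Set HexVertex) := by
    intro p
    have hs := he₁ p
    have hq := (e₁ p).2
    constructor
    · intro h v hv
      rcases h v (by rw [hs, List.mem_cons, List.mem_append]; exact Or.inr (Or.inl hv)) with
        h' | rfl | rfl
      · exact h'
      · exact absurd hv hq.2.1
      · exact absurd hv hq.2.2
    · intro h v hv
      rw [hs, List.mem_cons, List.mem_append, List.mem_singleton] at hv
      rcases hv with rfl | hv | rfl
      · exact Or.inr (Or.inl rfl)
      · exact Or.inl (h v hv)
      · exact Or.inr (Or.inr rfl)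
  have hback : ∀ q : {q : (hexDomainGraph Ω δ).Walk a' b' // q.IsPath ∧ ∀ w ∈ q.support,
      w ∈ (↑Λ : Set HexVertex)}, q.1.IsPath ∧ a ∉ q.1.support ∧ b ∉ q.1.support := fun q =>
    ⟨q.2.1, fun h => haΛ (q.2.2 a h), fun h => hbΛ (q.2.2 b h)⟩
  let e₀ : {γ : HexDomainSAW Ω δ a b // ∀ v ∈ γ.walk.support, v ∈ Λ ∨ v = a ∨ v = b} ≃
      {q : (hexDomainGraph Ω δ).Walk a' b' // q.IsPath ∧ ∀ w ∈ q.support,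
        w ∈ (↑Λ : Set HexVertex)} :=
    { toFun := fun γ => ⟨(e₁ ⟨γ.1.walk, γ.1.isPath⟩).1, (e₁ ⟨γ.1.walk, γ.1.isPath⟩).2.1,
        (hIn ⟨γ.1.walk, γ.1.isPath⟩).1 γ.2⟩
      invFun := fun q => ⟨⟨(e₁.symm ⟨q.1, hback q⟩).1, (e₁.symm ⟨q.1, hback q⟩).2⟩,
        (hIn (e₁.symm ⟨q.1, hback q⟩)).2 (by rw [Equiv.apply_symm_apply]; exact q.2.2)⟩
      left_inv := fun γ => by obtain ⟨⟨w, hw⟩, h⟩ := γ; simp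
      right_inv := fun q => by simp }
  rw [← Finset.sum_filter, Finset.sum_subtype (Finset.univ.filter fun γ : HexDomainSAW Ω δ a b =>
      ∀ v ∈ γ.walk.support, v ∈ Λ ∨ v = a ∨ v = b)
    (p := fun γ : HexDomainSAW Ω δ a b => ∀ v ∈ γ.walk.support, v ∈ Λ ∨ v = a ∨ v = b)
    (fun γ => by simp), Finset.mul_sum]
  refine Fintype.sum_equiv (e₀.trans (e₃.trans e₄)) _ _ fun γ => ?_
  have hlen : γ.1.vertexCount = (e₄ (e₃ (e₀ γ))).length + 2 := by
    have h := congrArg List.length (he₁ ⟨γ.1.walk, γ.1.isPath⟩)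
    rw [SimpleGraph.Walk.length_support, List.length_cons, List.length_append,
      List.length_singleton] at h
    rw [HexMidEdgeSAW.length, he₄, he₃]
    change γ.1.walk.length + 1 = (e₁ ⟨γ.1.walk, γ.1.isPath⟩).1.support.length + 2
    omega
  rw [Equiv.trans_apply, Equiv.trans_apply, hlen, pow_add, mul_comm]

/-- **`x² Z_{Λ'}(s_a, s_b) ≤ Σ_{γ canonical ∈ E ∩ In} x^{#vertices(γ)}`, pendant endpoints**
(`x ≥ 0`; `Λ' ⊆ Λ` inside `Ω'` without bad `Ω'`-edges, no bad edge inside `Λ`, `a' ∈ Λ'`,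
`a ≠ b` outside `Λ`, end-steps `a ∼ a'`, `b' ∼ b` edges of `Ω_δ` and `Ω'`-mesh edges,
`a, b ∈ Ω'`): `γ ↦ a :: γ ++ [b]`. [cite: LawlerSchrammWerner2004SAW, §3.4 ("SAW satisfies restriction")] -/
theorem sq_mul_sum_le_sum_ite_meshEvent_inside [Fintype (HexDomainSAW Ω δ a b)]
    (hΛ : ∀ v ∈ Λ, ∀ w ∈ Λ, hexGraph.Adj v w → (hexDomainGraph Ω δ).Adj v w)
    (hsub : Λ' ⊆ Λ) (hΛ'v : ∀ v ∈ Λ', v ∈ embMeshVertices hexCenter Ω' δ)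
    (hΛ'e : ∀ v ∈ Λ', ∀ w ∈ Λ', hexGraph.Adj v w →
      (embMeshGraph hexGraph hexCenter Ω' δ).Adj v w)
    (hab : a ≠ b) (haΛ : a ∉ Λ) (hbΛ : b ∉ Λ) (ha'Λ' : a' ∈ Λ')
    (haa' : (hexDomainGraph Ω δ).Adj a a') (hb'b : (hexDomainGraph Ω δ).Adj b' b)
    (hne : s(a', a) ≠ s(b', b))
    (haΩ' : a ∈ embMeshVertices hexCenter Ω' δ) (hbΩ' : b ∈ embMeshVertices hexCenter Ω' δ)
    (haa'G : (embMeshGraph hexGraph hexCenter Ω' δ).Adj a a')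
    (hb'bG : (embMeshGraph hexGraph hexCenter Ω' δ).Adj b' b) {x : ℝ} (hx : 0 ≤ x) :
    x ^ 2 * ∑ γ : HexMidEdgeSAW Λ' s(a', a) s(b', b), x ^ γ.length ≤
      ∑ γ : HexDomainSAW Ω δ a b,
        if ((∀ v ∈ γ.walk.support, v ∈ embMeshVertices hexCenter Ω' δ) ∧
              ∀ e ∈ γ.walk.darts, (embMeshGraph hexGraph hexCenter Ω' δ).Adj e.fst e.snd) ∧
            ∀ v ∈ γ.walk.support, v ∈ Λ ∨ v = a ∨ v = b
        then x ^ γ.vertexCount else 0 := by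
  have hadj : hexGraph.Adj a' a := (embDomainGraph_le hexGraph hexCenter Ω δ haa').symm
  obtain ⟨e₂, he₂⟩ := exists_equiv_isPath_of_le (embDomainGraph_le hexGraph hexCenter Ω δ)
    (Λ := (↑Λ' : Set HexVertex)) (fun v hv w hw h => hΛ v (hsub hv) w (hsub hw) h) a' b'
  obtain ⟨e₄, he₄⟩ := exists_equiv_isPath_hexMidEdgeSAW (vb := b') ha'Λ' (fun h => haΛ (hsub h))
    (fun h => hbΛ (hsub h)) hadj hne
  -- re-attach the two end-steps
  let ι : HexMidEdgeSAW Λ' s(a', a) s(b', b) → HexDomainSAW Ω δ a b := fun γ =>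
    ⟨SimpleGraph.Walk.cons haa' ((e₂.symm (e₄.symm γ)).1.concat hb'b), by
      have hq := (e₂.symm (e₄.symm γ)).2
      refine SimpleGraph.Walk.IsPath.cons (hq.1.concat (fun h => hbΛ (hsub (hq.2 b h))) hb'b) ?_
      rw [SimpleGraph.Walk.support_concat, List.mem_append, List.mem_singleton, not_or]
      exact ⟨fun h => haΛ (hsub (hq.2 a h)), hab⟩⟩
  have hqΛ' : ∀ γ, ∀ w ∈ (e₂.symm (e₄.symm γ)).1.support, w ∈ Λ' := fun γ w hw =>
    (e₂.symm (e₄.symm γ)).2.2 w hw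
  have hverts : ∀ γ, γ.verts = (e₂.symm (e₄.symm γ)).1.support := fun γ => by
    have h4 := he₄ (e₄.symm γ)
    have h2 := he₂ (e₂.symm (e₄.symm γ))
    rw [Equiv.apply_symm_apply] at h4 h2
    rw [h4, h2]
  have hι : ∀ γ, (ι γ).walk.support = a :: (γ.verts ++ [b]) := fun γ => by
    simp only [ι, SimpleGraph.Walk.support_cons, SimpleGraph.Walk.support_concat, hverts]
  have hinj : Function.Injective ι := fun γ₁ γ₂ h => by
    have h' := congrArg (fun γ : HexDomainSAW Ω δ a b => γ.walk.support) h
    simp only [hι, List.cons.injEq, true_and] at h'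
    exact HexMidEdgeSAW.ext (List.append_cancel_right h')
  have hlen : ∀ γ, (ι γ).vertexCount = γ.length + 2 := fun γ => by
    have h := congrArg List.length (hι γ)
    rw [SimpleGraph.Walk.length_support, List.length_cons, List.length_append,
      List.length_singleton] at h
    rw [HexMidEdgeSAW.length, ← h]
    rfl
  -- the image lies in `E ∩ In`
  have himg : ∀ γ, ((∀ v ∈ (ι γ).walk.support, v ∈ embMeshVertices hexCenter Ω' δ) ∧
      ∀ e ∈ (ι γ).walk.darts, (embMeshGraph hexGraph hexCenter Ω' δ).Adj e.fst e.snd) ∧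
      ∀ v ∈ (ι γ).walk.support, v ∈ Λ ∨ v = a ∨ v = b := by
    intro γ
    refine ⟨⟨fun v hv => ?_, fun e he => ?_⟩, fun v hv => ?_⟩
    · rw [hι, List.mem_cons, List.mem_append, List.mem_singleton] at hv
      rcases hv with rfl | hv | rfl
      · exact haΩ'
      · exact hΛ'v v (hqΛ' γ v ((hverts γ) ▸ hv))
      · exact hbΩ'
    · simp only [ι, SimpleGraph.Walk.darts_cons, SimpleGraph.Walk.darts_concat,
        List.concat_eq_append, List.mem_cons, List.mem_append, List.not_mem_nil, or_false] at he
      rcases he with rfl | he | rfl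
      · exact haa'G
      · exact hΛ'e _ (hqΛ' γ _ (SimpleGraph.Walk.dart_fst_mem_support_of_mem_darts _ he)) _
          (hqΛ' γ _ (SimpleGraph.Walk.dart_snd_mem_support_of_mem_darts _ he))
          (embDomainGraph_le hexGraph hexCenter Ω δ e.adj)
      · exact hb'bG
    · rw [hι, List.mem_cons, List.mem_append, List.mem_singleton] at hv
      rcases hv with rfl | hv | rfl
      · exact Or.inr (Or.inl rfl)
      · exact Or.inl (hsub (hqΛ' γ v ((hverts γ) ▸ hv)))
      · exact Or.inr (Or.inr rfl)
  rw [← Finset.sum_filter]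
  calc x ^ 2 * ∑ γ : HexMidEdgeSAW Λ' s(a', a) s(b', b), x ^ γ.length
      = ∑ γ : HexMidEdgeSAW Λ' s(a', a) s(b', b), x ^ (ι γ).vertexCount := by
        rw [Finset.mul_sum]
        exact Fintype.sum_congr _ _ fun γ => by rw [hlen, pow_add, mul_comm]
    _ = ∑ γ ∈ Finset.univ.map ⟨ι, hinj⟩, x ^ γ.vertexCount := by
        rw [Finset.sum_map]; rfl
    _ ≤ _ := by
        refine Finset.sum_le_sum_of_subset_of_nonneg (fun γ hγ => ?_) fun γ _ _ => pow_nonneg hx _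
        rw [Finset.mem_map] at hγ
        obtain ⟨γ', -, rfl⟩ := hγ
        rw [Finset.mem_filter]
        exact ⟨Finset.mem_univ _, himg γ'⟩

/-- **`Σ_{γ canonical ∈ E ∩ In} x^{#vertices(γ)} ≤ x² Z_{Λ''}(s_a, s_b)`, pendant endpoints**
(`x ≥ 0`; `a ≠ b` pendant with unique `Ω_δ`-neighbours `a', b' ∈ Λ'' ⊆ Λ`, `a' ≠ b`, outside
`Λ`; `Λ''` closed under `Ω'`-mesh steps inside `Λ`): a walk of `E ∩ In` stays in `Λ'' ∪ {a, b}`;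
strip its end-steps. [cite: LawlerSchrammWerner2004SAW, §3.4 ("SAW satisfies restriction")] -/
theorem sum_ite_meshEvent_inside_le_sq_mul_sum [Fintype (HexDomainSAW Ω δ a b)]
    (hsub : Λ'' ⊆ Λ)
    (hcl : ∀ v ∈ Λ'', ∀ w ∈ Λ, w ∈ embMeshVertices hexCenter Ω' δ →
      (embMeshGraph hexGraph hexCenter Ω' δ).Adj v w → w ∈ Λ'')
    (hab : a ≠ b) (haΛ : a ∉ Λ) (hbΛ : b ∉ Λ) (ha'' : a' ∈ Λ'') (hb'' : b' ∈ Λ'') (ha'b : a' ≠ b)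
    (ha : ∀ w, (hexDomainGraph Ω δ).Adj a w ↔ w = a')
    (hb : ∀ w, (hexDomainGraph Ω δ).Adj b w ↔ w = b') {x : ℝ} (hx : 0 ≤ x) :
    (∑ γ : HexDomainSAW Ω δ a b,
        if ((∀ v ∈ γ.walk.support, v ∈ embMeshVertices hexCenter Ω' δ) ∧
              ∀ e ∈ γ.walk.darts, (embMeshGraph hexGraph hexCenter Ω' δ).Adj e.fst e.snd) ∧
            ∀ v ∈ γ.walk.support, v ∈ Λ ∨ v = a ∨ v = b
        then x ^ γ.vertexCount else 0) ≤
      x ^ 2 * ∑ γ : HexMidEdgeSAW Λ'' s(a', a) s(b', b), x ^ γ.length := by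
  have hne := sym2_ne_of_pendant (a' := a') (b' := b') hab ha'b
  have hadj : hexGraph.Adj a' a := (embDomainGraph_le hexGraph hexCenter Ω δ ((ha a').2 rfl)).symm
  set S := Finset.univ.filter fun γ : HexDomainSAW Ω δ a b =>
    ((∀ v ∈ γ.walk.support, v ∈ embMeshVertices hexCenter Ω' δ) ∧
        ∀ e ∈ γ.walk.darts, (embMeshGraph hexGraph hexCenter Ω' δ).Adj e.fst e.snd) ∧
      ∀ v ∈ γ.walk.support, v ∈ Λ ∨ v = a ∨ v = b with hS
  obtain ⟨e₁, he₁⟩ := exists_equiv_isPath_pendant (G := hexDomainGraph Ω δ) hab ha hb ha'b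
  obtain ⟨e₄, he₄⟩ := exists_equiv_isPath_hexMidEdgeSAW (vb := b') ha'' (fun h => haΛ (hsub h))
    (fun h => hbΛ (hsub h)) hadj hne
  -- walks of the event stay in `Λ'' ∪ {a, b}`
  have hsuppS : ∀ γ : ↥S, ∀ w ∈ γ.1.walk.support, w ∈ Λ'' ∨ w = a ∨ w = b := by
    rintro ⟨γ, hγ⟩
    rw [hS, Finset.mem_filter] at hγ
    obtain ⟨-, ⟨hEv, hEe⟩, hIn⟩ := hγ
    refine support_subset_of_darts_closed_loc (S := {w | w ∈ Λ'' ∨ w = a ∨ w = b}) γ.walk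
      (Or.inr (Or.inl rfl)) fun d hd hd1 => ?_
    rcases hd1 with hd1 | hd1 | hd1
    · rcases hIn _ (γ.walk.dart_snd_mem_support_of_mem_darts hd) with h2 | h2 | h2
      · exact Or.inl (hcl _ hd1 _ h2 (hEv _ (γ.walk.dart_snd_mem_support_of_mem_darts hd))
          (hEe d hd))
      · exact Or.inr (Or.inl h2)
      · exact Or.inr (Or.inr h2)
    · refine Or.inl ?_
      rw [(ha d.snd).1 (hd1 ▸ d.adj)]
      exact ha''
    · refine Or.inl ?_
      rw [(hb d.snd).1 (hd1 ▸ d.adj)]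
      exact hb''
  -- hence the stripped walk stays in `Λ''`
  have hsupp : ∀ γ : ↥S, ∀ w ∈ ((e₁ ⟨γ.1.walk, γ.1.isPath⟩).1.mapLe
      (embDomainGraph_le hexGraph hexCenter Ω δ)).support, w ∈ Λ'' := by
    intro γ w hw
    rw [SimpleGraph.Walk.support_mapLe_eq_support] at hw
    have hq := (e₁ ⟨γ.1.walk, γ.1.isPath⟩).2
    have hw' : w ∈ γ.1.walk.support := by
      rw [he₁ ⟨γ.1.walk, γ.1.isPath⟩, List.mem_cons, List.mem_append]
      exact Or.inr (Or.inl hw)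
    rcases hsuppS γ w hw' with h | rfl | rfl
    · exact h
    · exact absurd hw hq.2.1
    · exact absurd hw hq.2.2
  let ι : ↥S → HexMidEdgeSAW Λ'' s(a', a) s(b', b) := fun γ =>
    e₄ ⟨(e₁ ⟨γ.1.walk, γ.1.isPath⟩).1.mapLe (embDomainGraph_le hexGraph hexCenter Ω δ),
      (SimpleGraph.Walk.isPath_mapLe _).2 (e₁ ⟨γ.1.walk, γ.1.isPath⟩).2.1, hsupp γ⟩
  have hι : ∀ γ : ↥S, γ.1.walk.support = a :: ((ι γ).verts ++ [b]) := fun γ => by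
    simp only [ι, he₄, SimpleGraph.Walk.support_mapLe_eq_support]
    exact he₁ ⟨γ.1.walk, γ.1.isPath⟩
  have hinj : Function.Injective ι := by
    intro γ₁ γ₂ h
    have h' : γ₁.1.walk.support = γ₂.1.walk.support := by rw [hι, hι, h]
    obtain ⟨⟨w₁, hw₁⟩, h₁⟩ := γ₁
    obtain ⟨⟨w₂, hw₂⟩, h₂⟩ := γ₂
    obtain rfl : w₁ = w₂ := SimpleGraph.Walk.ext_support h'
    rfl
  have hlen : ∀ γ : ↥S, γ.1.vertexCount = (ι γ).length + 2 := fun γ => by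
    have h := congrArg List.length (hι γ)
    rw [SimpleGraph.Walk.length_support, List.length_cons, List.length_append,
      List.length_singleton] at h
    rw [HexMidEdgeSAW.length, ← h]
    rfl
  rw [← Finset.sum_filter]
  calc ∑ γ ∈ S, x ^ γ.vertexCount
      = ∑ γ : ↥S, x ^ 2 * x ^ (ι γ).length := by
        rw [← Finset.sum_coe_sort]
        exact Fintype.sum_congr _ _ fun γ => by rw [hlen, pow_add, mul_comm]
    _ = ∑ γ ∈ Finset.univ.map ⟨ι, hinj⟩, x ^ 2 * x ^ γ.length := by
        rw [Finset.sum_map]; rfl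
    _ ≤ ∑ γ : HexMidEdgeSAW Λ'' s(a', a) s(b', b), x ^ 2 * x ^ γ.length :=
        Finset.sum_le_sum_of_subset_of_nonneg (Finset.subset_univ _)
          fun γ _ _ => mul_nonneg (pow_nonneg hx _) (pow_nonneg hx _)
    _ = x ^ 2 * ∑ γ : HexMidEdgeSAW Λ'' s(a', a) s(b', b), x ^ γ.length := by
        rw [Finset.mul_sum]

/-- **Registered sub-goal `stub_canonicalTransfer_squeezePendant`** (crux item
stmt-CriticalPhenomena-10472, line `floor-ratio-restriction-bootstrap`, stub
`stub_canonicalTransfer`): THE FIXED-SCALE SQUEEZE with pendant canonical endpoints.  Let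
`Λ' ⊆ Λ'' ⊆ Λ` be finite vertex sets with: every honeycomb edge inside `Λ` an edge of `Ω_δ`;
`Λ' ⊆ Ω'` with all inner honeycomb edges `Ω'`-mesh edges; `Λ''` closed under `Ω'`-mesh steps
inside `Λ`; let the endpoints `a ≠ b` be pendant vertices of `Ω_δ` outside `Λ`, with unique
`Ω_δ`-neighbours `a', b' ∈ Λ'`, `a' ≠ b`, lying in `Ω'` with `Ω'`-mesh end-steps `a ∼ a'`,
`b' ∼ b`.  Then for `P = hexSAWLaw Ω δ a b`, the event `E` of `stub_canonicalTransfer`,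
`In = {γ ⊆ Λ ∪ {a,b}}` and `s_a = {a',a}`, `s_b = {b',b}`:
`P(In)·Z_{Λ'}(s_a,s_b) ≤ P(E ∩ In)·Z_Λ(s_a,s_b)` and `P(E ∩ In)·Z_Λ(s_a,s_b) ≤ P(In)·Z_{Λ''}(s_a,s_b)`
(i.e. `Z_{Λ'}/Z_Λ ≤ P(E | In) ≤ Z_{Λ''}/Z_Λ`; the factors `x_c²` of the forced end-steps cancel).
[cite: LawlerSchrammWerner2004SAW, §3.4 ("SAW satisfies restriction")] -/
theorem stub_canonicalTransfer_squeezePendant :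
    ∀ (Ω Ω' : Set ℂ) (δ : ℝ) (Λ Λ' Λ'' : Finset HexVertex) (a b a' b' : HexVertex)
    [Fintype (HexDomainSAW Ω δ a b)],
    (∀ v ∈ Λ, ∀ w ∈ Λ, hexGraph.Adj v w → (hexDomainGraph Ω δ).Adj v w) →
    Λ' ⊆ Λ'' → Λ'' ⊆ Λ → (∀ v ∈ Λ', v ∈ embMeshVertices hexCenter Ω' δ) →
    (∀ v ∈ Λ', ∀ w ∈ Λ', hexGraph.Adj v w → (embMeshGraph hexGraph hexCenter Ω' δ).Adj v w) →
    (∀ v ∈ Λ'', ∀ w ∈ Λ, w ∈ embMeshVertices hexCenter Ω' δ →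
      (embMeshGraph hexGraph hexCenter Ω' δ).Adj v w → w ∈ Λ'') →
    a ≠ b → a ∉ Λ → b ∉ Λ → a' ∈ Λ' → b' ∈ Λ' → a' ≠ b →
    (∀ w : HexVertex, (hexDomainGraph Ω δ).Adj a w ↔ w = a') →
    (∀ w : HexVertex, (hexDomainGraph Ω δ).Adj b w ↔ w = b') →
    a ∈ embMeshVertices hexCenter Ω' δ → b ∈ embMeshVertices hexCenter Ω' δ →
    (embMeshGraph hexGraph hexCenter Ω' δ).Adj a a' →
    (embMeshGraph hexGraph hexCenter Ω' δ).Adj b' b →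
    ((hexSAWLaw Ω δ a b) {γ | ∀ v ∈ γ.walk.support, v ∈ Λ ∨ v = a ∨ v = b}).toReal *
          ∑ γ : HexMidEdgeSAW Λ' s(a', a) s(b', b), hexCriticalFugacity ^ γ.length ≤
        ((hexSAWLaw Ω δ a b)
            ({γ | (∀ v ∈ γ.walk.support, v ∈ embMeshVertices hexCenter Ω' δ) ∧
                ∀ e ∈ γ.walk.darts, (embMeshGraph hexGraph hexCenter Ω' δ).Adj e.fst e.snd} ∩
              {γ | ∀ v ∈ γ.walk.support, v ∈ Λ ∨ v = a ∨ v = b})).toReal *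
          ∑ γ : HexMidEdgeSAW Λ s(a', a) s(b', b), hexCriticalFugacity ^ γ.length ∧
      ((hexSAWLaw Ω δ a b)
            ({γ | (∀ v ∈ γ.walk.support, v ∈ embMeshVertices hexCenter Ω' δ) ∧
                ∀ e ∈ γ.walk.darts, (embMeshGraph hexGraph hexCenter Ω' δ).Adj e.fst e.snd} ∩
              {γ | ∀ v ∈ γ.walk.support, v ∈ Λ ∨ v = a ∨ v = b})).toReal *
          ∑ γ : HexMidEdgeSAW Λ s(a', a) s(b', b), hexCriticalFugacity ^ γ.length ≤
        ((hexSAWLaw Ω δ a b) {γ | ∀ v ∈ γ.walk.support, v ∈ Λ ∨ v = a ∨ v = b}).toReal *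
          ∑ γ : HexMidEdgeSAW Λ'' s(a', a) s(b', b), hexCriticalFugacity ^ γ.length := by
  intro Ω Ω' δ Λ Λ' Λ'' a b a' b' _ hΛ hsub' hsub hΛ'v hΛ'e hcl hab haΛ hbΛ ha'Λ' hb'Λ' ha'b ha hb
    haΩ' hbΩ' haa'G hb'bG
  have hx := hexCriticalFugacity_pos_lt_one.1.le
  have hne := sym2_ne_of_pendant (a' := a') (b' := b') hab ha'b
  -- the two probabilities as ratios
  have hIn : ((hexSAWLaw Ω δ a b) {γ | ∀ v ∈ γ.walk.support, v ∈ Λ ∨ v = a ∨ v = b}).toReal =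
      hexCriticalFugacity ^ 2 *
        (∑ γ : HexMidEdgeSAW Λ s(a', a) s(b', b), hexCriticalFugacity ^ γ.length) /
        ∑ γ : HexDomainSAW Ω δ a b, hexCriticalFugacity ^ γ.vertexCount := by
    rw [hexSAWLaw_apply_toReal_eq_div, ← sum_ite_inside_eq_sq_mul_sum hΛ hab haΛ hbΛ
      (hsub (hsub' ha'Λ')) ha'b ha hb, ← Finset.sum_filter]
    congr 1
    refine Finset.sum_congr ?_ fun _ _ => rfl
    ext γ
    simp only [Finset.mem_filter, Finset.mem_univ, true_and, Set.mem_setOf_eq]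
  have hEIn : ((hexSAWLaw Ω δ a b)
      ({γ | (∀ v ∈ γ.walk.support, v ∈ embMeshVertices hexCenter Ω' δ) ∧
          ∀ e ∈ γ.walk.darts, (embMeshGraph hexGraph hexCenter Ω' δ).Adj e.fst e.snd} ∩
        {γ | ∀ v ∈ γ.walk.support, v ∈ Λ ∨ v = a ∨ v = b})).toReal =
      (∑ γ : HexDomainSAW Ω δ a b,
        if ((∀ v ∈ γ.walk.support, v ∈ embMeshVertices hexCenter Ω' δ) ∧
              ∀ e ∈ γ.walk.darts, (embMeshGraph hexGraph hexCenter Ω' δ).Adj e.fst e.snd) ∧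
            ∀ v ∈ γ.walk.support, v ∈ Λ ∨ v = a ∨ v = b
        then hexCriticalFugacity ^ γ.vertexCount else 0) /
        ∑ γ : HexDomainSAW Ω δ a b, hexCriticalFugacity ^ γ.vertexCount := by
    rw [hexSAWLaw_apply_toReal_eq_div, ← Finset.sum_filter]
    congr 1
    refine Finset.sum_congr ?_ fun _ _ => rfl
    ext γ
    simp only [Finset.mem_filter, Finset.mem_univ, true_and, Set.mem_setOf_eq, Set.mem_inter_iff]
  have hlow := sq_mul_sum_le_sum_ite_meshEvent_inside hΛ (hsub'.trans hsub) hΛ'v hΛ'e hab haΛ hbΛ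
    ha'Λ' ((ha a').2 rfl) (((hb b').2 rfl).symm) hne haΩ' hbΩ' haa'G hb'bG hx
  have hup := sum_ite_meshEvent_inside_le_sq_mul_sum (Ω := Ω) (Ω' := Ω') (δ := δ) hsub hcl hab
    haΛ hbΛ (hsub' ha'Λ') (hsub' hb'Λ') ha'b ha hb hx
  have hZc : 0 ≤ ∑ γ : HexDomainSAW Ω δ a b, hexCriticalFugacity ^ γ.vertexCount :=
    Finset.sum_nonneg fun γ _ => pow_nonneg hx _
  have hZΛ : 0 ≤ ∑ γ : HexMidEdgeSAW Λ s(a', a) s(b', b), hexCriticalFugacity ^ γ.length :=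
    Finset.sum_nonneg fun γ _ => pow_nonneg hx _
  rw [hIn, hEIn]
  rcases hZc.eq_or_lt with h0 | hpos
  · rw [← h0]; simp
  · constructor
    · rw [div_mul_eq_mul_div, div_mul_eq_mul_div, div_le_div_iff_of_pos_right hpos]
      linarith [mul_le_mul_of_nonneg_right hlow hZΛ]
    · rw [div_mul_eq_mul_div, div_mul_eq_mul_div, div_le_div_iff_of_pos_right hpos]
      linarith [mul_le_mul_of_nonneg_right hup hZΛ]

end Pendant

end Summit.CriticalPhenomena.SAWScalingLimit.Theorems.ObservableToSLE.FloorRatio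

end
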